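import Mathlib
import HarnessLib

/-!
# `RegularTwistCM` (stmt-Langlands-14069) — negative knowledge I: the archimedean shadow

Sorry-free exponent / unit bookkeeping behind the load-bearing analysis of the crux
`Summit.Langlands.Langlands.Theses.IrreducibilityBySelfDuality.RegularTwistCM` (K CM, π regular
algebraic cuspidal on GL₃ with `t_π = d · Ad(t_{σ₀})` a.e. ⇒ some GL(1)-twist of `σ₀` is regular
algebraic), from the standing disprover's `Cruxes/RegularTwistCM/Disproof.lean` (cdisprove cycle 1).
Mathlib-only real/complex arithmetic; no automorphic object is mentioned, so nothing here asserts a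
Theses decl.

* `IsCMField` is load-bearing: at a REAL place the weight parity is imprinted on the modulus exponent of
  any C-algebraic twist (`realPlace_twist_exponent`), Weil's unit condition over a real quadratic field
  forces parallel modulus exponents (`parallel_of_unit_condition`, `…_finiteIndex`), so for the
  weights-`(2,3)` Hilbert newform over `ℚ(√2)` no twist can be C-algebraic
  (`archShadow_mixedParity_obstructed`) — the archimedean shadow of Patrikis arXiv:1207.6724 Prop. 1.3.3;
  at a COMPLEX place both parities are available (`complexPlace_twist_exists`,
  `complexPlace_twist_exists_integral`).
* `IsRegularAlgebraic π` is load-bearing: Maass-type exponents admit no algebraic twist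
  (`maassType_noAlgebraicTwist`, `…_real`).
* The strengthening "χ algebraic" is false: undoing `|det|^{iy}` needs a non-algebraic `χ`
  (`imaginaryTwist_notAlgebraic`).
* Weil's criterion, real part: exponents pairing to zero with the trace-zero hyperplane are parallel
  (`parallel_of_vanishing_on_traceZero`); imaginary parts only satisfy a lattice condition, whence the
  squares trick (`squares_trick`) — and index 2 cannot be dropped (`squares_trick_tight`).
[folklore]
-/

namespace Summit.Langlands.Langlands.Theorems.RegularTwistCM.Negative

open scoped BigOperators

/-- LOCAL PARITY FREEDOM AT A COMPLEX PLACE (the CM lever, local half). For exponents `s₁ t₁ : ℂ` with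
`s₁ - t₁ ∈ ℤ` (a character of `ℂ^×`) and `a : ℤ` (so `s₂ = s₁ - a`, `t₂ = t₁ + a` after purity
`b = -a`), the twist `u = 1/2 - s₁`, `v = 1/2 - t₁` is a character of `ℂ^×` (`u - v ∈ ℤ`) making all four
exponents lie in `1/2 + ℤ`, regular as soon as `a ≠ 0`, with modulus exponent `u + v = 1 - (s₁ + t₁)`
(= `1 - Σ_w/2`). [folklore] -/
theorem complexPlace_twist_exists (s₁ t₁ : ℂ) (a : ℤ) (hst : ∃ m : ℤ, s₁ - t₁ = m) :
    ∃ u v : ℂ, (∃ m : ℤ, u - v = m) ∧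
      (∃ k : ℤ, s₁ + u = k + 1 / 2) ∧ (∃ k : ℤ, (s₁ - a) + u = k + 1 / 2) ∧
      (∃ l : ℤ, t₁ + v = l + 1 / 2) ∧ (∃ l : ℤ, (t₁ + a) + v = l + 1 / 2) ∧
      (a ≠ 0 → s₁ + u ≠ (s₁ - a) + u) ∧ u + v = 1 - (s₁ + t₁) := by
  obtain ⟨m, hm⟩ := hst
  refine ⟨1 / 2 - s₁, 1 / 2 - t₁, ⟨-m, ?_⟩, ⟨0, ?_⟩, ⟨-a, ?_⟩, ⟨0, ?_⟩, ⟨a, ?_⟩, ?_, ?_⟩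
  · push_cast; linear_combination -hm
  · push_cast; ring
  · push_cast; ring
  · push_cast; ring
  · ring
  · intro ha h
    apply ha
    have : (a : ℂ) = 0 := by linear_combination h
    exact_mod_cast this
  · ring

/-- BOTH PARITIES ARE AVAILABLE AT A COMPLEX PLACE (why the `ρ`-shift hazard is moot over CM, F4): the
same data also admit a twist making all exponents INTEGRAL (L-algebraic), `u = -s₁`, `v = -t₁`. [folklore] -/
theorem complexPlace_twist_exists_integral (s₁ t₁ : ℂ) (a : ℤ) (hst : ∃ m : ℤ, s₁ - t₁ = m) :
    ∃ u v : ℂ, (∃ m : ℤ, u - v = m) ∧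
      (∃ k : ℤ, s₁ + u = k) ∧ (∃ k : ℤ, (s₁ - a) + u = k) ∧
      (∃ l : ℤ, t₁ + v = l) ∧ (∃ l : ℤ, (t₁ + a) + v = l) := by
  obtain ⟨m, hm⟩ := hst
  refine ⟨-s₁, -t₁, ⟨-m, ?_⟩, ⟨0, ?_⟩, ⟨-a, ?_⟩, ⟨0, ?_⟩, ⟨a, ?_⟩⟩
  · push_cast; linear_combination -hm
  · simp
  · push_cast; ring
  · simp
  · ring

/-- NO PARITY FREEDOM AT A REAL PLACE (shadow of F3, `IsCMField` load-bearing): twisting the weight-`k`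
discrete series parameter `{(k-1)/2, -(k-1)/2}` by `|·|^u` lands in `1/2 + ℤ` only for `u ∈ k/2 + ℤ` —
the parity of `k` is imprinted on the modulus exponent. [cite: Patrikis2019, Prop. 1.3.3] -/
theorem realPlace_twist_exponent (k : ℤ) (u : ℝ) (h : ∃ m : ℤ, ((k : ℝ) - 1) / 2 + u = 1 / 2 + m) :
    ∃ m : ℤ, u = (k : ℝ) / 2 + m := by
  obtain ⟨m, hm⟩ := h
  exact ⟨m + 1 - k, by push_cast; linarith⟩

/-- MIXED PARITY ⇒ NON-PARALLEL MODULUS EXPONENTS: weights `k₁ = 2`, `k₂ = 3` force `u₁ ∈ ℤ`,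
`u₂ ∈ 1/2 + ℤ`, hence `u₁ ≠ u₂`. [cite: Patrikis2019, Prop. 1.3.3] -/
theorem mixedParity_exponents_ne (u₁ u₂ : ℝ) (h₁ : ∃ m : ℤ, u₁ = ((2 : ℤ) : ℝ) / 2 + m)
    (h₂ : ∃ m : ℤ, u₂ = ((3 : ℤ) : ℝ) / 2 + m) : u₁ ≠ u₂ := by
  obtain ⟨m₁, hm₁⟩ := h₁
  obtain ⟨m₂, hm₂⟩ := h₂
  intro h
  have h' : ((2 * m₁ - 2 * m₂ : ℤ) : ℝ) = 1 := by push_cast; push_cast at hm₁ hm₂; linarith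
  have h'' : (2 * m₁ - 2 * m₂ : ℤ) = 1 := by exact_mod_cast h'
  omega

/-- WEIL'S UNIT CONDITION OVER A REAL QUADRATIC FIELD FORCES PARALLEL MODULUS EXPONENTS (shadow of the
`IsCMField` bullet of F3): if `x > 0`, `x ≠ 1` is a totally positive unit (with conjugate `x⁻¹`) and the
archimedean character `|·|_{w₁}^{u₁} |·|_{w₂}^{u₂}` is trivial on it, then `u₁ = u₂`. [cite: Weil1956, unit criterion; Patrikis2019 Lemma 2.1.1] -/
theorem parallel_of_unit_condition {x : ℝ} (hx : 0 < x) (hx1 : x ≠ 1) (u₁ u₂ : ℝ)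
    (h : x ^ u₁ * x⁻¹ ^ u₂ = 1) : u₁ = u₂ := by
  have hlog : Real.log (x ^ u₁ * x⁻¹ ^ u₂) = 0 := by rw [h, Real.log_one]
  have hx' : 0 < x⁻¹ := inv_pos.mpr hx
  rw [Real.log_mul (Real.rpow_pos_of_pos hx _).ne' (Real.rpow_pos_of_pos hx' _).ne',
    Real.log_rpow hx, Real.log_rpow hx', Real.log_inv] at hlog
  have hlogx : Real.log x ≠ 0 := Real.log_ne_zero_of_pos_of_ne_one hx hx1
  have : (u₁ - u₂) * Real.log x = 0 := by linear_combination hlog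
  rcases mul_eq_zero.mp this with h0 | h0
  · linarith
  · exact absurd h0 hlogx

/-- The same on a FINITE-INDEX subgroup (Weil's criterion only asks triviality on some `x^{Nℤ}`, `N ≥ 1`):
`(x^{u₁} x^{-u₂})^N = 1` with a positive base still forces `u₁ = u₂`. [cite: Weil1956, unit criterion] -/
theorem parallel_of_unit_condition_finiteIndex {x : ℝ} (hx : 0 < x) (hx1 : x ≠ 1) (u₁ u₂ : ℝ)
    {N : ℕ} (hN : N ≠ 0) (h : (x ^ u₁ * x⁻¹ ^ u₂) ^ N = 1) : u₁ = u₂ := by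
  have hpos : 0 ≤ x ^ u₁ * x⁻¹ ^ u₂ :=
    mul_nonneg (Real.rpow_nonneg hx.le _) (Real.rpow_nonneg (inv_pos.mpr hx).le _)
  exact parallel_of_unit_condition hx hx1 u₁ u₂ ((pow_eq_one_iff_of_nonneg hpos hN).mp h)

/-- `3 + 2√2 = (1 + √2)²` is a totally positive unit of `ℚ(√2)` with conjugate `3 - 2√2 = (3 + 2√2)⁻¹`.
[folklore] -/
theorem sqrt2_unit_inv : (3 - 2 * Real.sqrt 2 : ℝ) = (3 + 2 * Real.sqrt 2)⁻¹ := by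
  have h2 : Real.sqrt 2 * Real.sqrt 2 = 2 := Real.mul_self_sqrt (by norm_num)
  have hpos : (3 + 2 * Real.sqrt 2 : ℝ) ≠ 0 := by positivity
  field_simp
  linear_combination (-4 : ℝ) * h2

/-- THE ARCHIMEDEAN SHADOW OF `RegularTwistCM` WITHOUT `IsCMField` IS OBSTRUCTED (sorry-free core of
`regularTwistCM_false_without_IsCMField`): over `F = ℚ(√2)` with `σ₀` of weights `(k₁, k₂) = (2, 3)`,
there are NO modulus exponents `(u₁, u₂)` of a twisting character that are (i) C-algebraic at both real
places (`(k_i - 1)/2 + u_i ∈ 1/2 + ℤ`) and (ii) trivial on a finite-index subgroup `(3+2√2)^{Nℤ}` of the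
totally positive units (Weil's necessary condition for `χ` to exist). [cite: Patrikis2019, Prop. 1.3.3 and Lemma p. 32] -/
theorem archShadow_mixedParity_obstructed :
    ¬ ∃ u₁ u₂ : ℝ, (∃ m : ℤ, (((2 : ℤ) : ℝ) - 1) / 2 + u₁ = 1 / 2 + m) ∧
        (∃ m : ℤ, (((3 : ℤ) : ℝ) - 1) / 2 + u₂ = 1 / 2 + m) ∧
        ∃ N : ℕ, N ≠ 0 ∧
          ((3 + 2 * Real.sqrt 2) ^ u₁ * (3 - 2 * Real.sqrt 2) ^ u₂) ^ N = 1 := by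
  rintro ⟨u₁, u₂, h₁, h₂, N, hN, h⟩
  have hx : (0 : ℝ) < 3 + 2 * Real.sqrt 2 := by positivity
  have hx1 : (3 + 2 * Real.sqrt 2 : ℝ) ≠ 1 := by
    have : (0 : ℝ) ≤ Real.sqrt 2 := Real.sqrt_nonneg 2
    intro h; linarith
  rw [sqrt2_unit_inv] at h
  have hpar := parallel_of_unit_condition_finiteIndex hx hx1 u₁ u₂ hN h
  exact mixedParity_exponents_ne u₁ u₂ (realPlace_twist_exponent 2 u₁ h₁)
    (realPlace_twist_exponent 3 u₂ h₂) hpar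

/-- MAASS-TYPE SHADOW (core of `regularTwistCM_false_without_RegularAlgebraic`): exponents `{u + c, u - c}`
(`c = ir`, or any `c` with `2c ∉ ℤ`) are never both in `1/2 + ℤ`; contrapositively, both in `1/2 + ℤ`
forces `2c ∈ ℤ`. [cite: Clozel1990, Déf. 1.8] -/
theorem maassType_noAlgebraicTwist (u c : ℂ) (h₁ : ∃ k : ℤ, u + c = k + 1 / 2)
    (h₂ : ∃ k : ℤ, u - c = k + 1 / 2) : ∃ m : ℤ, 2 * c = m := by
  obtain ⟨k₁, hk₁⟩ := h₁
  obtain ⟨k₂, hk₂⟩ := h₂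
  exact ⟨k₁ - k₂, by push_cast; linear_combination hk₁ - hk₂⟩

/-- In particular for `c = i r` with `r` real, algebraic twistability forces `r = 0` (no Maass type).
[cite: Clozel1990, Déf. 1.8] -/
theorem maassType_noAlgebraicTwist_real (u : ℂ) (r : ℝ)
    (h₁ : ∃ k : ℤ, u + Complex.I * r = k + 1 / 2) (h₂ : ∃ k : ℤ, u - Complex.I * r = k + 1 / 2) :
    r = 0 := by
  obtain ⟨m, hm⟩ := maassType_noAlgebraicTwist u (Complex.I * r) h₁ h₂
  have him := congrArg Complex.im hm
  simp at him
  linarith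

/-- IMAGINARY-TWIST SHADOW (core of `not_RegularTwistCMAlgebraicTwist`): if `s` is C-algebraic
(`s ∈ 1/2 + ℤ`) and `s + iy + u` is again in `1/2 + ℤ` with `u` ALGEBRAIC (`u ∈ ℤ` or `1/2 + ℤ`, i.e.
`2u ∈ ℤ`), then `y = 0`: undoing `|det|^{iy}` needs a non-algebraic `χ`. [cite: Weil1956, type (A₀) characters] -/
theorem imaginaryTwist_notAlgebraic (s u : ℂ) (y : ℝ) (hs : ∃ k : ℤ, s = k + 1 / 2)
    (hu : ∃ m : ℤ, 2 * u = m) (h : ∃ k : ℤ, s + Complex.I * y + u = k + 1 / 2) : y = 0 := by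
  obtain ⟨k, hk⟩ := hs
  obtain ⟨m, hm⟩ := hu
  obtain ⟨k', hk'⟩ := h
  have him := congrArg Complex.im hk'
  have hmu : u.im = 0 := by
    have := congrArg Complex.im hm
    simpa using this
  have hsi : s.im = 0 := by
    have := congrArg Complex.im hk
    simpa using this
  simp [hmu, hsi] at him
  exact him

/-- THE SQUARES TRICK (F2, second correction): if a real-valued additive functional `L` on a lattice `Λ`
(here: `u ↦ Σ_w Im(Σ_w) log u_w` on the totally positive `K⁺`-units where `ω_{σ₀,∞} = 1`) takes values
in `2πℤ`, then `L/2` takes values in `2πℤ` on `2Λ` (the squares `U²`). This is what makes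
`χ_∞ = exp(-(1/2)·L)` trivial on a finite-index subgroup WITHOUT `Σ_w` being place-independent. [folklore] -/
theorem squares_trick {Λ : Type*} [AddCommGroup Λ] (L : Λ →+ ℝ)
    (h : ∀ x, ∃ k : ℤ, L x = 2 * Real.pi * k) (x : Λ) :
    ∃ k : ℤ, L (2 • x) / 2 = 2 * Real.pi * k := by
  obtain ⟨k, hk⟩ := h x
  exact ⟨k, by rw [map_nsmul, hk]; ring⟩

/-- TIGHTNESS of the squares trick: index 2 cannot be dropped in general — `L(Λ) ⊆ 2πℤ` does not give
`(L/2)(Λ) ⊆ 2πℤ` (`Λ = ℤ`, `L x = 2πx`, `x = 1`). So a proof of the crux that checks triviality of `χ_∞`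
on `U` itself (rather than on `U²` or another deeper finite-index subgroup) is checking something false
for Maass-type central characters. [folklore] -/
theorem squares_trick_tight :
    ∃ L : ℤ →+ ℝ, (∀ x, ∃ k : ℤ, L x = 2 * Real.pi * k) ∧ ¬ ∀ x, ∃ k : ℤ, L x / 2 = 2 * Real.pi * k := by
  refine ⟨zmultiplesHom ℝ (2 * Real.pi), fun x => ⟨x, ?_⟩, fun hall => ?_⟩
  · rw [zmultiplesHom_apply, zsmul_eq_mul, mul_comm]
  · obtain ⟨k, hk⟩ := hall 1
    rw [zmultiplesHom_apply, one_zsmul] at hk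
    have h1 : Real.pi * (1 - 2 * k) = 0 := by linear_combination hk
    rcases mul_eq_zero.mp h1 with h | h
    · exact Real.pi_ne_zero h
    · have : (1 : ℝ) = 2 * k := by linarith
      have h2 : (1 : ℤ) = 2 * k := by exact_mod_cast this
      omega

/-- WEIL'S CRITERION, REAL PART (F2): a linear functional `x ↦ Σ_w c_w x_w` vanishing on the trace-zero
hyperplane (spanned by the unit log-lattice of `K⁺`) has all `c_w` equal — this is why `Re Σ_w` (and the
real part of any Hecke character's modulus exponents) is place-independent, while imaginary parts only
satisfy a lattice condition. Stated for the hyperplane itself (the lattice spans it by Dirichlet). [cite: Weil1956, unit criterion] -/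
theorem parallel_of_vanishing_on_traceZero {ι : Type*} [Fintype ι] [DecidableEq ι] (c : ι → ℝ)
    (h : ∀ x : ι → ℝ, ∑ w, x w = 0 → ∑ w, c w * x w = 0) (w₁ w₂ : ι) : c w₁ = c w₂ := by
  by_cases hw : w₁ = w₂
  · rw [hw]
  · have := h (Pi.single w₁ 1 - Pi.single w₂ 1) (by
      simp [Finset.sum_sub_distrib])
    simp [mul_sub, Finset.sum_sub_distrib, Pi.single_apply] at this
    linarith

end Summit.Langlands.Langlands.Theorems.RegularTwistCM.Negative
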